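import Mathlib
import HarnessLib
import HarnessLib.Audit
import Summits.HodgeConjecture.Statement
import Literature.AlgebraicGeometry.HodgeTheory.FermatShiodaCondition
import Literature.AlgebraicGeometry.HodgeTheory.HodgeModelExistence
import Literature.AlgebraicGeometry.HodgeTheory.DiagonalSymmetry
import Literature.AlgebraicGeometry.HodgeTheory.GysinFormalism
import Literature.AlgebraicGeometry.Motives.Sweep1
import Summits.HodgeConjecture.HodgeConjecture.Theorems.NodalSupportHodgeModels
import HarnessLib.Audit.Status.Attr

/-!
Route: DerivedTorelliFermat

# Route DerivedTorelliFermat — Fermat fourfolds = Shioda–Aoki supply + the REALISABLE K3 sector of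
accidental Hodge isomorphisms, audited by derived Torelli (HC for X⁴ₘ modulo its residual
eigenlines; rev 4 = route-choice after the refutation of K3Exhaustion; rev 5 = same line, cone-light
spelling: V(α) inline, transport glue filed as the support TargetGlue)

DECLARED SECTOR ROUTE (sector = the Fermat fourfolds X⁴ₘ : Σᵢ₌₀⁵ xᵢᵐ = 0, every degree m, MINUS
their residual eigenlines; frame to the summit = the explicit NOT-claimed support
ResidualSectorComplement, as in KugaSatakeSaturation / HeckePrymWeil). Card
derived-torelli-audits-fermat (spine). It suffices to show X = K3SectorAlgebraic (rank 2, restated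
at rev 4): for every m and every Hodge character α of X⁴ₘ (Shioda's 𝔅⁴ₘ, length 3) in the REALISABLE
K3 SECTOR — α ∼ β#γ with β a K3-TYPE character of the Fermat surface Sₘ = X²ₘ (exactly one character
of Hodge level |·| = 1 in the unit orbit of β, i.e. h²·⁰(V[β]) = 1) whose unit orbit has at most 21
elements (rank V[β] = φ(d′) ≤ 21 = the maximal rank of the transcendental lattice of a projective K3
surface), and β₃ + γ₃ = 0 — the eigenline V(α) ⊂ H⁴(X⁴ₘ(ℂ);ℂ) consists of algebraic classes, because
V(β#γ) is the image of the accidental Hodge isomorphism V[β] ≅ V[−γ] between two K3-type CM pieces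
of H²(Sₘ,ℚ) (any two K3-type pieces of the same order are ℚ-Hodge isomorphic), which factors through
Delsarte CM K3 surfaces T(Y_β)_ℚ ≅ V[β] (Shioda maps, algebraic) and a Hodge isometry of K3 surfaces
(Buskin2019 / Huybrechts2019, algebraic when the multiplier is a norm — POSITIVE at m = 33 by the
refuter's exact norm-class test, evidence on stmt-HodgeConjecture-11120). Every other Hodge
character is either SHIODA–AOKI REACHABLE (its multiset plus some pairs {e,−e} is a sum of pairs,
Fermat-surface Hodge characters (Lefschetz), C×C characters and Aoki's p-standard elements σ_{p,a},
p | m an odd prime, d = m/p, d/(a,d) > 2 — the supply that is algebraic in print, support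
ShiodaAokiSupply) or RESIDUAL (not claimed: the hypothesis of the target).
ROUTE-CHOICE (rev 4, 2026-08-15). The rev-0 rank-4 crux K3Exhaustion ("no residual character exists,
any m") is REFUTED in substance — negative edge
Summit.HodgeConjecture.HodgeConjecture.Theorems.DerivedTorelliFermatK3Exhaustion_refuted (m = 110:
the Hodge sextuple {1,24,62,71,81,91} is unreachable for every Q by an odd additive invariant ψ of
M₁₁₀ and every 3+3 split has h²·⁰ = 2). DECISION: NEXT LINE, not retirement — the refutation kills
the ∀m exhaustion "supply ∨ K3 sector", not the K3 engine (Delsarte realisation +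
Buskin/Huybrechts), whose first target m = 33 is untouched and whose norm-class test is positive.
The rev-3 repair (target restated MODULO THE RESIDUAL, pre-registered kill criterion (i)) is KEPT
and SHARPENED so that the crux coincides with its mechanism: K3-type Fermat pieces of rank φ(d′) =
24 exist (orders d′ = 35, 45, 70, 90; refuter rattack-11119, census to m = 200) and are carried by
no K3 surface, so accidental isomorphisms between them leave the crux and join the residual — first
instance m = 70: ONE unit orbit, that of {1,20,24,42,61,62} (24 sextuples, every K3 split of rank
24; planner census calc/census.py = refuter g46-1), then the higher-genus residual named by the
refutation (m = 110: 2 unit orbits; 114: 3; …). The EXACT residual census below 110 rides as the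
support ResidualCensusBelow110 (residual = ∅ for every m ≤ 109 except m = 70's orbit); with the
target it gives HC for every smooth projective Fermat fourfold of degree ≤ 109, m ≠ 70, from the
items alone (Sketch.lean corollary_below110, rc 0) — first new case m = 33 (crux
Fermat33AccidentalClass = da Silva's non-quasi-decomposable class = the accidental isomorphism
V[(1,4,30,31)] ≅ V[(1,12,22,31)] on S₃₃ × S₃₃; milestone FermatFourfoldThirtyThree), then m = 99
(its 3-pullback, the only other degree below 110 where the K3 engine is load-bearing).
COHOMOLOGY SPELLING (rev 5, route-repair / cone guardrail 2026-08-16; no change of mathematics). In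
every item the eigenline V(α) ⊂ H⁴(V₊(Σxᵢᵐ)(ℂ);ℂ) is written INLINE as the simultaneous eigenspace
{c | g_a^* c = (∏ᵢ aᵢ^⟨αᵢ⟩)·c for every a ∈ (ℂˣ)⁶ with aᵢᵐ = 1 in the diagonal stabiliser of Σxᵢᵐ}
over the fact-free file DiagonalSymmetry (diagonalStabilizer, diagonalMap) — this IS Shioda's V(α) =
fermatEigenspace m α 4 (mem_fermatEigenspace_iff + fermatCharacter_apply; planner certificate
Bridge.lean `memPred_iff`) — and the standard model as SmoothHypersurface.hypersurface
(fermatPolynomial ℂ 4 m) (= the abbrev fermatHypersurface 4 m). Each restated item is EQUIVALENT to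
its rev-4 original (Bridge.lean k3Sector_iff, fermat33_iff, supply_iff, eigenspaceInputs_iff,
target_iff; 0 sorries), so the rev-4 vetting, censuses and refuter notes
(stmt-HodgeConjecture-13927/11120/13928/11123/13829 and the negative edge
stmt-HodgeConjecture-11121) stay authoritative. Effect: the route file imports only
FermatShiodaCondition, DiagonalSymmetry, GysinFormalism, Sweep1 (no unproved named fact in their
cones) and HodgeModelExistence for the ONE genuinely needed named fact nonempty_hodgeModel
(needs-fact; item HodgeModels = conjunct 1 of HodgeConjectureFor, shared by ten routes) — instead of
FermatHodgeConjectureAssembly, whose cone (via FermatHypersurfaceReduction → ComplexConjugation /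
FermatHodgeConjectureProofs / HodgeConjectureQbarVoisinProofs) carried 17 unproved named facts
(Kähler–Hodge package, Hodge decomposition, exists_isReal_hodgeModel, hodgeClasses_algebraic_fermat,
Voisin 2007, Deligne/Charles–Schnell) that no item or proof of this route uses.
Lean: `K3SectorAlgebraic`

## Assembly
Deciding theorem (glue.lean, rev 5; items-only logic, lean check rc 0): `closes (hT : TargetGlue)
(hL : HypersurfaceLefschetz) (hM : HodgeModels) (hE : EigenspaceInputs) (hS : ShiodaAokiSupply) (hK
: K3SectorAlgebraic) (hC : ResidualSectorComplement) : _root_.HodgeConjecture := hC (hT hL hM hE hS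
hK)`. The mathematics of the rev-4 deciding theorem is now the support item TargetGlue :
HypersurfaceLefschetz → HodgeModels → EigenspaceInputs → ShiodaAokiSupply → K3SectorAlgebraic →
FermatFourfoldsHCModResidual, PROVED by the planner (Bridge.lean `targetGlue_holds`, 0 sorries,
axioms propext/Classical.choice/Quot.sound; attached as evidence — a prover copies it into
Theorems/, importing FermatHodgeConjectureAssembly there): for a Fermat fourfold X of degree m ≥ 1
with algebraic residual eigenlines (hypothesis hR of the target) the model conjunct is hM; off the
middle degree algebraicClasses X p = ⊤ (tree: algebraicClasses_zero,
algebraicClasses_eq_top_of_eq_zero_or_le, and hL for 0 < p < 4); in degree 4 every Hodge character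
is reachable (hS), realisable-K3-sector (hK) or residual (hR) by classical trichotomy, giving the
input hB of the tree theorem mem_algebraicClasses_fermat_middle_of_eigenspaces (p = 2) together with
hE (inline predicate ↔ fermatEigenspace by memPred_iff), on the standard model V₊(Σxᵢᵐ); transport
along X ≅ V₊(Σxᵢᵐ) (IsFermatVariety.isoFermatHypersurface, IsOfHodgeType.map_of_iso,
IsRationalClass.map, mem_algebraicClasses_map_of_iso, map_hom_map_inv_apply). The Assembly item is
the same chain as a Prop: TargetGlue → HypersurfaceLefschetz → HodgeModels → EigenspaceInputs →
ShiodaAokiSupply → K3SectorAlgebraic → ResidualSectorComplement → HodgeConjecture (Sketch.lean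
`assembly_holds`, one line from `closes`).

Rationale: WHY THIS LINE. Shioda1979HodgeFermat/Shioda1979PJA reduce HC(Xⁿₘ) to the combinatorics (Pₘ) of the
character semigroup Mₘ plus the inductive structure; Aoki1987 (Thm 1-4, Thm 2-1, pp. 385–388) adds
pair-cancellation and explicit cycles for the p-standard elements σ_{p,a} (d = m/p, d/(a,d) > 2) and
leaves exactly the "semi-standard" elements open; daSilva2021HodgeFermat (arXiv:2101.04739, Prop.
3.6) exhibits the first failure of (P⁴ₘ) at m = 33. Exact lattice censuses (parts are
negation-closed, so reachability = ℤ-span membership; planner calc/census.py m ≤ 112 and seven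
refuter censuses to m ≤ 180, evidence on stmt-HodgeConjecture-11121) show that below m = 110 the
length-3 elements of Mₘ outside the Shioda–Aoki supply are: da Silva's unit class at m = 33 (4
sextuples) and its 3-pullback at m = 99 (4) — both accidental Hodge ISOMORPHISMS between two K3-type
CM sub-Hodge structures of H²(Sₘ) of rank φ(33) = 20, the one sector of any motive where "accidental
Hodge isomorphisms are algebraic" is a THEOREM (Mukai1987ModuliBundlesK3, Buskin2019, Huybrechts2019
Rem. 3.3) once both pieces are transcendental lattices of K3 surfaces, supplied here by
Delsarte/Fermat-quotient K3 surfaces (Shioda1986, LivneSchuttYui2010 = arXiv:0904.1922) — plus ONE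
unit orbit at m = 70 whose K3-type pieces have rank φ(35) = φ(70) = 24 > 21 (no K3 carries them: rev
4 moves it to the residual). REV 4 (route-choice after the substantive refutation of K3Exhaustion at
m = 110, Theorems.DerivedTorelliFermatK3Exhaustion_refuted): next line = the rev-3 repair (target
modulo the residual, Aoki's printed guard, census as support) with the K3 clause cut to
K3-realisable rank (unit orbit of β ≤ 21), so that every instance of the crux is within reach of the
Delsarte + Buskin/Huybrechts engine; the engine-less accidental classes (rank-24 K3-type at m ∈ 35ℕ
∪ 45ℕ, higher genus from m = 110) are the declared residual. Imported: derived/twisted Torelli and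
CM theory of K3 surfaces into Shioda's character calculus; certified finite computation organises
the attack. No prior route touches Fermat degrees beyond Shioda's list except p-adically
(SupersingularIsotypicLift, PadicSemiregularLift). REV 5 (route-repair 2026-08-16, no change of
mathematics): the five V(α)-items respelled with the eigenspace predicate inline (each ↔ its rev-4
original, Bridge.lean) so that the import cone carries 1 declared instead of 18 unproved named
facts; the transport glue of the rev-4 deciding theorem is now the support TargetGlue (proved,
Bridge.lean), which also answers the badge finding 'no item concludes the target'.

RANKED CRUXES. #0 FermatFourfoldsHCModResidual (target, restated rev 4; rev 5 = same statement with
V(α) inline, ↔ stmt-HodgeConjecture-13928 by Bridge.lean target_iff) — for every m ≥ 1: if the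
residual eigenlines of X⁴ₘ (Hodge characters neither Shioda–Aoki reachable with Aoki's p-standard
parts nor realisable-K3-sector) are algebraic — vacuous for every m ≤ 109 except m = 70 (one unit
orbit) — then HC holds for every smooth projective Fermat fourfold of degree m; PROVED from the
items below — that implication is the support TargetGlue (planner Bridge.lean targetGlue_holds, 0
sorries); with ResidualCensusBelow110 it gives HC for all Fermat fourfolds of degree ≤ 109, m ≠ 70
(new for m = 33, 66, 78, 99, 102, …; known: m prime, m ≤ 21, 27, prime powers (Aoki1987 Cor. 2-3),
2ᵃ3ᵇ5ᶜ7ᵈ with cd = 0, 2pᵉ (Aoki 2000), (m,6) = 1 (daSilva Thm 3.3)). (why it might fail: an instance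
family of HC: one non-algebraic reachable or realisable-K3 eigenline refutes it and HC.)
[Shioda1979PJA, Shioda1979HodgeFermat, Aoki1987, arXiv:2101.04739]
#2 K3SectorAlgebraic (crux, restated rev 4: realisable rank; rev 5: V(α) inline, ↔
stmt-HodgeConjecture-13927 by Bridge.lean k3Sector_iff — its vetting and evidence carry over) — for
every m and every Hodge character α of X⁴ₘ whose multiset is {β₀,β₁,β₂} + {γ₀,γ₁,γ₂} with β : Fin 4
→ ℤ/m admissible, K3-TYPE (exactly one δ = t·β, t a unit, with Σ⟨δᵢ⟩ = m), unit orbit of β of size ≤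
21, and β₃ + γ₃ = 0 — the eigenline V(α) ⊂ H⁴(V₊(Σxᵢᵐ)(ℂ);ℂ) lies in the ℂ-span of codimension-2
cycle classes. Card items K1 (Delsarte realisation: V[β] ≅ T(Y_β)_ℚ algebraically for a
Fermat-quotient CM K3 Y_β) + K2 (multiplier of the Hodge similitude T(Y_β)_ℚ → T(Y_γ)_ℚ is a norm
from ℚ(ζ_d′) ⇒ isometry ⇒ algebraic by Buskin/Huybrechts) pushed to X⁴ₘ by Shioda's type-I
correspondence S×S ⇢ X⁴ (da Silva Thm 2.2(c)). Implied by the rev-3 statement (rchoice planner's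
Sketch.lean k3Sector_of_rev3). [difficulty: XL] (why it might fail: a Delsarte K3 realises ONE
character orbit (LivneSchuttYui2010 Rem. 4) and φ(d′) = 20 orbits (d′ = 33, 44, 50, 66) need rank
T(Y) = 20, ρ(Y) = 2 — the second orbit of a pair may have no algebraic realisation; or the
multiplier u ∉ ℚ>0·N(E×) (no Hodge isometry; only the KS-conditional Varesco Thm 5.3).) [Buskin2019,
Huybrechts2019, Mukai1987ModuliBundlesK3, Shioda1986, LivneSchuttYui2010, Aoki1987, Varesco2023]
#3 Fermat33AccidentalClass (crux; rev 5: V(α) inline, ↔ stmt-HodgeConjecture-11120 by Bridge.lean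
fermat33_iff — the positive norm-class test and refuter notes on stmt-HodgeConjecture-11120 carry
over) — on the Fermat fourfold of degree 33 the eigenlines V(α) for α in the unit class of da
Silva's non-quasi-decomposable character (7,10,13,19,22,28) (4 multisets; Prop. 3.6 of
arXiv:2101.04739) are algebraic: the accidental Hodge isomorphism V[(1,4,30,31)] ≅ V[(1,12,22,31)]
(rank φ(33) = 20 each, CM by ℚ(ζ₃₃)); recipe: realise both orbits as T(Y)_ℚ of K3 surfaces with a
purely non-symplectic automorphism of order 33/66 (the unique X₆₆ of LivneSchuttYui2010 and its
Fermat dominations), compute the multiplier from the Jacobi-sum forms (refuter rattack-11120: the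
norm-class test is POSITIVE under the Pham normalisation λ_β ≐ ∏(1−ζ^{βᵢ})), apply Buskin.
[difficulty: L] (why it might fail: the Delsarte realisation may give T(Y)_ℚ ≅ V[β] only up to a
non-norm twist, or the order-33/66 CM K3 surfaces may realise only one of the two orbits.)
[arXiv:2101.04739, Buskin2019, Huybrechts2019, LivneSchuttYui2010]
#9 ResidualCensusBelow110 (support, NEW rev 4, finite certified computation; replaces
K3ExhaustionBelow110) — for every m < 110 every Hodge multiset of cardinality 6 in ℤ/m is
Shioda–Aoki reachable (parts: Hodge multisets of cardinality ≤ 4, Hodge semi-decomposable sextuples,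
Aoki p-standard elements with 2·(a,d) < d; plus cancelling pairs) OR realisable-K3-sector OR (m = 70
and a unit multiple of {1,20,24,42,61,62}). Evidence: planner calc/census.py + calc/census_4_120.txt
(exact; unreachable below 110 only at 33 (4), 70 (24 = that orbit), 99 (4); reproduces every refuter
count) and refuter g46-1's independent census; closable by native_decide from witness tables. (why
it might fail: census-only; a guard/part-list mismatch with the typed clauses at some m ≤ 109
refutes it — repair = add the exception, the glue does not use this item.) [Aoki1987,
arXiv:2101.04739, Theorems.DerivedTorelliFermatK3ExhaustionRefutation]
#10 TargetGlue (support at rank 10 = rendered after the rank-9 supports it names; NEW rev 5; glue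
answering the badge finding target-unreachable) — HypersurfaceLefschetz → HodgeModels →
EigenspaceInputs → ShiodaAokiSupply → K3SectorAlgebraic → FermatFourfoldsHCModResidual: the rev-4
deciding theorem minus its frame (middle degree on the standard model by
mem_algebraicClasses_fermat_middle_of_eigenspaces at p = 2, Lefschetz off it, transport along X ≅
V₊(Σxᵢᵐ)); PROVED by the planner in Bridge.lean (targetGlue_holds, 0 sorries; evidence on the item)
— a prover copies it into Theorems/ (importing FermatHodgeConjectureAssembly there is harmless).
[difficulty: S] [Shioda1979PJA, Ran1980]
#9 ShiodaAokiSupply (support, rev 3 guard; rev 5: V(α) inline, ↔ stmt-HodgeConjecture-13829 by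
Bridge.lean supply_iff) — (known in print; formalisation debt) for every Hodge character α of X⁴ₘ
whose multiset is Shioda–Aoki reachable in the above sense, V(α) consists of algebraic classes:
Lefschetz (1,1) on X²ₘ and on X¹ₘ × X¹ₘ, Shioda's inductive structure of types I/II
(Shioda1979HodgeFermat Thm I–II; daSilva Thm 2.2/Cor 2.3), pair cancellation claim(α∗δ) ⇒ claim(α)
(tree fact Aoki1987_claim_of_claim_juxtaposition_paired), Aoki's subvariety for p-standard elements
with (a,d) = 1 (tree fact Aoki1987_claim_pStandard) and, for (a,d) = g > 1 with d/g > 2, the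
pullback of the level-m/g cycle along X_m → X_{m/g} (ShiodaKatsura1979 §1: π*V(σ′) = V(gσ′)) —
load-bearing at m ∈ {50, 75, 100, 105}. [difficulty: XL] [Shioda1979HodgeFermat, Shioda1979PJA,
Aoki1987, Ran1980, ShiodaKatsura1979, arXiv:2101.04739]
#9 EigenspaceInputs (support; rev 5: V(α) inline, ↔ stmt-HodgeConjecture-11123 by Bridge.lean
eigenspaceInputs_iff) — (known; Ran1980 Prop. 1.7 (i)–(ii), Shioda1979HodgeFermat (1.7) and
Hⁿ(Xⁿₘ)^G = Hⁿ(ℙⁿ)) the three eigenspace inputs hE2, hE0, hE4 of the tree theorem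
mem_algebraicClasses_fermat_middle_of_eigenspaces at p = 2. [difficulty: L] [Ran1980,
Shioda1979HodgeFermat, Shioda1979PJA]
#9 HypersurfaceLefschetz (support) — the tree's cite_only fact
Voisin2003_smoothHypersurface_algebraicClasses_eq_top, verbatim. [difficulty: L] [VoisinHodgeII2003]
#9 HodgeModels (support, shared by ten routes) — ∀ n X, nonempty_hodgeModel n X; needs-fact:
Literature.AlgebraicGeometry.HodgeTheory.nonempty_hodgeModel — the ONE unproved named fact left in
the route's import cone, GENUINELY needed (conjunct 1 of HodgeConjectureFor: every route to
HodgeConjecture must produce a Hodge model); tier-0 Literature debt (discharge path in tree: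
HodgeModelExistenceDischarge.nonempty_hodgeModel_of_deRham_of_hodgeDecomposition). [difficulty: L]
[SerreGAGA1956, VoisinHodgeI2002]
#9 FermatFourfoldThirtyThree (support, milestone) — HC for the Fermat fourfold of degree 33: from
the target and the m = 33 case of ResidualCensusBelow110 (990 Hodge multisets, 4 unreachable, all
realisable-K3, residual ∅; Sketch.lean thirtyThree_of), i.e. from Fermat33AccidentalClass +
ShiodaAokiSupply at m = 33 + EigenspaceInputs + HypersurfaceLefschetz + HodgeModels. [difficulty: L]
[arXiv:2101.04739, Shioda1979PJA]
#9 ResidualSectorComplement (support, bookkeeping, NOT claimed) — FermatFourfoldsHCModResidual →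
HodgeConjecture: the complement of the route's sector, containing the RESIDUAL SECTOR — the
eigenlines V(α) of X⁴ₘ with α neither reachable nor realisable-K3: m = 70: the unit orbit of
{1,20,24,42,61,62} (accidental isomorphisms between RANK-24 K3-type pieces of H²(S₇₀), orders 35/70
— no K3 surface); m = 110: unit orbits of {1,24,62,71,81,91}, {1,31,55,71,81,91}; m = 114: three
orbits (accidental Hodge morphisms between CM pieces with h²·⁰ = 2 — da Silva's 'candidates for a
counter-example'); nothing else below 113. Nobody is asked to prove it; graders should judge the
route on K3SectorAlgebraic / Fermat33AccidentalClass. [difficulty: open-problem] [Deligne2000]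
#1 Assembly (assembly, restated rev 5) — TargetGlue → HypersurfaceLefschetz → HodgeModels →
EigenspaceInputs → ShiodaAokiSupply → K3SectorAlgebraic → ResidualSectorComplement → HodgeConjecture
(= closes curried; Sketch.lean assembly_holds).
RETIRED at rev 5 by restatement (cone hygiene only; each EQUIVALENT to its successor by Bridge.lean,
ids kept as the home of the rev-4 evidence): the rev-4 spellings of FermatFourfoldsHCModResidual
(stmt-HodgeConjecture-13928), K3SectorAlgebraic (13927), Fermat33AccidentalClass (11120),
EigenspaceInputs (11123), ShiodaAokiSupply (13829) over fermatEigenspace/fermatHypersurface, and the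
rev-3 Assembly (13830).
RETIRED at rev 4 by restatement: the rev-3 K3SectorAlgebraic (rank-free K3 clause, contained
engine-less instances at m = 70, 140, 175, …), the rev-3 target and K3ExhaustionBelow110 (TRUE as
typed, superseded by the exact census). DROPPED (rev 3): K3Exhaustion (stmt-HodgeConjecture-11121,
REFUTED — negative edge in the negatives index; the rev-5 repair brief's retire candidate, already
answered by the rev-4 route-choice), FermatFourfoldsHC, FourfoldSectorComplement, the rev-0
ShiodaAokiSupply guard and the rev-0 Assembly.

TWO-LAYER PLAN. K3SectorAlgebraic ⇐ DelsarteRealisation → NormClassIsometry → K3SectorAlgebraic,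
where DelsarteRealisation: every K3-type orbit [β] of order d′ with φ(d′) ≤ 20 that occurs in a
realisable-K3 split of a NON-reachable Hodge character (below 110: only d′ = 33, at m = 33 and 99)
is, ℚ(ζ)-equivariantly and by an ALGEBRAIC correspondence S_N ⇢ Y, the transcendental lattice T(Y)_ℚ
of a Delsarte/Fermat-quotient K3 surface Y (Shioda1986 exponent matrices; LivneSchuttYui2010, X₆₆
for d′ = 33); NormClassIsometry: for two realised orbits of equal order the Hodge similitude
T(Y_β)_ℚ → T(Y_γ)_ℚ has multiplier in ℚ>0·N_{E/F}(E×) (Jacobi-sum discriminants), hence after an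
E-rescaling and a Nikulin/Kummer rational factor it is a Hodge ISOMETRY, algebraic by Buskin2019
(tree fact Buskin2019_hodgeIsometry_algebraic) / Huybrechts2019 Rem 3.3. A prover may propose the
glued split "K3SectorAlgebraic ⇐ (reachable case = ShiodaAokiSupply) + (non-reachable realisable
case)". Fermat33AccidentalClass ⇐ the same two children at d′ = 33 (glue: composition of
correspondences + Shioda type-I map). ResidualCensusBelow110 ⇐ per-degree native_decide files (m =
33 first), no items. Nothing here is filed now.

KILL CRITERIA. (i) USED (rev 3/4): a Hodge multiset outside supply ∪ realisable-K3 sector does not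
kill the line but lands in the residual — a further such discovery below 110 can now only hit
ResidualCensusBelow110 (repair: add the exception; the glue does not use it). (ii) For m = 33: if
NEITHER order-33 orbit [1,4,30,31], [1,12,22,31] is the character orbit of a Fermat domination of a
K3 surface (X₆₆ or another Delsarte K3), the engine has nothing to say about Fermat33AccidentalClass
— close the route exhausted (the only other engine degree below 110, m = 99, is the pullback of the
same pair). (iii) A refutation of Fermat33AccidentalClass or K3SectorAlgebraic is a counterexample
to the Hodge conjecture (route closes refuted:…, summit refuted). (iv) If a refuter shows that for
EVERY pair of inequivalent realisable K3-type orbits of equal order at most one is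
Delsarte-realisable and the cross multipliers are non-norms, the mechanism is empty — close
exhausted after recording the census. (v) Proved elsewhere: HodgeFermatVarieties
(PadicSemiregularLift) or FermatHodge (SupersingularIsotypicLift) moot the target but not the
K3-sector mechanism.

NOT DECOMPOSED YET. The two children of K3SectorAlgebraic (Delsarte realisation; norm-class
isometry) — layer 2, after Fermat33AccidentalClass is decided. The RESIDUAL SECTOR — (a) m = 70:
accidental isomorphisms between rank-24 K3-type pieces (orders 35/70; by
LivneSchuttYui2010/Machida–Oguiso no K3 surface has a purely non-symplectic automorphism of these
orders and rank 24 > 21 excludes any K3 realisation; the natural carriers are hyperkähler or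
abelian: K3^[n]-type is useless (its transcendental part is that of a K3), so the carriers are the
CM abelian varieties attached to these pieces (Shioda–Katsura domination of S₇₀ by C₇₀ × C₇₀; van
Geemen's half twist) — Weil-type classes, André's CM remark), (b) m = 110, 114, …: accidental Hodge
morphisms between CM pieces of H²(Sₘ) with h²·⁰ ≥ 2 — where the only unconditional engine is
Markman's secant-sheaf construction (Weil classes on abelian sixfolds of split Weil type, hence all
Weil-type fourfolds and HC in dimension ≤ 5: arXiv:2502.03415; survey arXiv:2509.23403) — is
deliberately NOT decomposed: it is a new idea card (secant sheaves / hyperkähler carriers for K =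
ℚ(ζ_d)), not a crux of this thesis. Higher dimensions n ≥ 6, products Sₘ × Sₘ themselves, the
structural (Stickelberger/Jacobi-sum) description of the residual degrees {70, 110, 114, …}, and the
formalisation of the Shioda–Aoki supply on real carriers (blow-up correspondences; the
degree-pullback lemma π*V(σ′) = V(gσ′)) — support debt shared with the tree's
hodgeClasses_algebraic_fermat programme.

CHEAPEST FALSIFIER. DONE (rev 0–4, planner + refuters): the exhaustion census — it FOUND the m = 110
witness (refutation) and the m = 70 rank-24 orbit (this route-choice); the m = 33 norm-class test —
POSITIVE. NEXT cheapest (refuter, hours): (a) the Delsarte realisation test at d′ = 33: list the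
character orbits 𝔖_G ∖ 𝔅 of the Fermat dominations F_N ⇢ X₆₆ (LivneSchuttYui2010 §'Delsarte
surfaces', k = 66; Shioda1986 exponent matrices of all Delsarte K3s with an order-33/66 symmetry)
and check that BOTH orbits [1,4,30,31] and [1,12,22,31] occur — if one is missing for every Delsarte
model, kill criterion (ii) fires; (b) re-run ResidualCensusBelow110 from the TYPED clauses in
Lean-adjacent form (per-m witness tables) — any mismatch refutes that support only; (c) the m = 25
calibration (orbits [1,6,7,11], [1,6,20,23], algebraic by Aoki's 5-standard cycle).

NUMBERS. Planner census calc/census.py (exact lattice criterion, relaxed printed guard, K3 clause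
literal with orbit sizes; m = 4..112): Hodge sextuples m = 33: 990 / unreachable 4 = da Silva's unit
class, realisable-K3 (orbit pair [1,4,30,31] ~ [1,12,22,31], size 20); 50: 4477 / 0 (the 44
typed-unreachable classes are reached through imprimitive 5-standard pullbacks); 70: 10948 / 24 =
the unit orbit of {1,20,24,42,61,62}, every one of the six K3 splits of every member has orbit size
24 (orders 35 and 70) — RESIDUAL; 75: 10361 / 0; 99: 22427 / 4 (3-pullback of m = 33, size 20); 105:
0 unreachable (relaxed guard); 110: 36782 / 48 = two unit orbits, no K3 split at all (h²·⁰ = 2) —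
RESIDUAL, = the refutation witnesses; 111, 112: 0; every other m ≤ 112: 0 unreachable. Refuter data
(stmt-HodgeConjecture-11121 evidence): typed-guard failures at 105, 110, 114, 130, 150, 165, 168,
170 (m ≤ 180); relaxed guard: 110, 114 below 150; realisable-vs-rank-24: primitive K3-type orbits
exist for the 37 Machida–Oguiso orders ∪ {35, 45, 70, 90} (φ = 24; rattack-11119, m ≤ 200); K3-only
orbits outside the supply lattice (typed guard, g43-25): 33, 50 (3), 70 (2), 75, 99, 100 (3), 105,
120, 125, 140 (2), 150 (4), 165, 175 (2). φ(33) = 20 = rank T of the order-33/66 CM K3 surface X₆₆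
(unique, LivneSchuttYui2010 Thm 1–2).

DEFINITION REQUESTS. None blocking (all items elaborate over existing declarations; K3-type, the
orbit bound, reachability and the p-standard parts are spelled inline, the latter verbatim as in the
tree fact Aoki1987_claim_pStandard). Nice-to-have, for the layer-2 children and for
ResidualCensusBelow110's prover: `Literature/AlgebraicGeometry/HodgeTheory`:
`FermatCharacter.IsK3Type` (the inline ∃!-predicate) with `unitOrbit β : Finset _` and its
cardinality φ(d′), `FermatCharacter.IsShiodaAokiReachable` (the inline reachability predicate), a
carrier `fermatGaloisPiece m β ⊂ complexBetti (fermatHypersurface 2 m) 2` with its ℚ-structure, and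
the degree map `fermatPowerMap g : fermatHypersurface n (g*m') ⟶ fermatHypersurface n m'` with
π*V(α′) = V(gα′); cite facts wanted: Aoki, Math. Ann. 266 (1983) 23–54 (semi-standard elements, Thm
D; acq-03503) and Machida–Oguiso 1998 / Kondō 1992 (orders of purely non-symplectic automorphisms: φ
≤ 20, ≠ 60). LITERATURE IMPORT HYGIENE (rev 5; filed as a definition request — it would let a 1:1
restate fold the inline spelling back to fermatEigenspace/fermatHypersurface and unblock every
Fermat route at once): (a) move the topological lemma IsRationalClass.map out of
ComplexConjugation.lean (which declares exists_isReal_hodgeModel and imports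
Motives.HodgeDecomposition → KaehlerHodge + HodgeModelExistence: 13 unproved named facts) and drop
that import from DiagonalCharacterEigenspace.lean; (b) move fermatHypersurface,
is{SmoothHypersurface,SmoothProjective,FermatVariety}_fermatHypersurface,
IsFermatVariety.isoFermatHypersurface and the Transport lemmas out of
FermatHypersurfaceReduction.lean into a file not importing FermatHodgeConjectureProofs /
HodgeConjectureQbarVoisinProofs / ComplexConjugation (4 more facts).

Novelty: Searches (2026-08-15): card's own searches + refuter novelty audit (Huybrechts 1705.04063 Rem 3.3,
Ramón-Marí 2008 Thm 3.3, BFK 1105.3177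
Thm 10.31 read by the auditor); this session: `lit read arxiv:2101.04739` (da Silva, pp. 1–9 read:
Thm 2.2, Cor 2.3, Def 2.4, Thm 2.5–2.8,
Prop 3.1, Thm 3.3, Prop 3.6, Prop 3.7, φ-table), `lit read doi:10.2969/jmsj/03930385` (Aoki1987, pp.
385–388, 396 read: Thm 1-1–1-4, 2-1,
Cor 2-3, refs), `lit read doi:10.1007/bf01455974` (only the erratum of Aoki 1983 is held), `lit
galaxy search "Hodge cycles on Fermat
varieties" --star all` (0), `lit galaxy search "… semi-standard …" --star pdf --mode intelligent` (8
irrelevant), `lit search "Aoki new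
algebraic cycles Fermat …"` ×3 (searchd unavailable, rc 75), lean search of the tree's
Fermat/K3/Delsarte layers, all 44 Theses of the
sub read by title/status and the four Fermat + six K3 cards via the card's Distinguishes-from.
Nearest prior art found: Aoki1987 (Thm 1-4 + Thm 2-1: the complete known supply; semi-standard
elements declared open); arXiv:2101.04739
(P₃₃ false, explicit class, no mechanism proposed beyond Newton-identity cycles); Huybrechts2019 Rem
3.3 / Buskin2019 (HC for S×S′ of CM K3s
given a Hodge isometry); arXiv:0904.1922 (extremal non-symplectic K3s are Fermat quotients — the
dictionary, used for modularity only).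
Delta: nobody has observed that the open (semi-standard) Hodge classes on Fermat fourfolds are — by
exact census for m ≤ 54 — precisely
accidental Hodge isomorphisms betwe  [refs: 10.2969/jmsj/03930385`, 10.1007/bf01455974`, 2101.04739, 0904.1922, arxiv:2101.04739, doi:10.2969/jmsj/03930385, doi:10.1007/bf01455974, Aoki1987, Huybrechts2019, Buskin2019]

Barriers (technique_class: fermat-motives, derived-torelli-k3, computation): - technique_class: fermat-motives, derived-torelli-k3, computation
- Literature.Barriers.HodgeConjecture.Mumford1968_simpleFourfold_exceptionalHodgeClasses: the
targets ARE exceptional classes (outside the divisor ring of Sₘ × Sₘ / of X⁴ₘ's linear-space span);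
evaded by importing cycles from moduli of (twisted) sheaves on K3 surfaces and Delsarte quotient
maps, not from divisors or linear subspaces (Weil1977_exceptionalHodgeClasses likewise).
- Literature.Barriers.HodgeConjecture.Andre1996_hodgeClassesOnAbelianVarieties_motivated: Fermat
motives are of CM abelian type, so every class here is motivated/absolute Hodge; the route
constructs cycles and never argues "motivated ⇒ algebraic", so the barrier (and
HodgeClassesAreAbsoluteFor) neither helps nor obstructs — it is why a failed norm-class test refutes
nothing.
- Literature.Barriers.HodgeConjecture.AtiyahHirzebruch1962_torsionClass_notAlgebraic: rational
coefficients throughout (ℂ-spans of cycle classes, ℚ-Hodge structures);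
Kollar1992_nonTorsionClass_notAlgebraic likewise not touched.
- Literature.Barriers.HodgeConjecture.Zucker1977_kaehlerTorus_noAnalyticCycles: projectivity is used
essentially (Buskin's moduli of sheaves on projective K3s; Delsarte surfaces are projective);
nothing is claimed for non-algebraic K3-type Hodge structures (KaehlerCoherentSheaves file
likewise).
- Literature.Barriers.HodgeConjecture.Serre1964_conjugateVarieties_notHomeomorphic: no transport of
Betti classes along Aut(ℂ); Galois enters only th

History (route lifecycle, newest last):
- 2026-08-15T21:08:59Z · BROKEN — K3Exhaustion (stmt-HodgeConjecture-11121, crux) refuted by Summit.HodgeConjecture.HodgeConjecture.Theorems.DerivedTorelliFermatK3Exhaustion_refuted @ cab5fce94e33 (refuter-refute-pool-g43-4)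
- 2026-08-15T21:29:30Z · rev 3: restated FermatFourfoldsHC (stmt-HodgeConjecture-11118), FourfoldSectorComplement (stmt-HodgeConjecture-11126), ShiodaAokiSupply (stmt-HodgeConjecture-11122), Assembly (stmt-HodgeConjecture-11127) — repair (route-repair rfix; the route's pre-registered kill criterion (i)): K3Exhaustion (stmt-HodgeConjecture-1112 (planner-rfix-HodgeConjecture-DerivedTorelliF-11b1dd57-0)
- 2026-08-15T21:29:30Z · rev 3: dropped K3Exhaustion — repair (route-repair rfix; the route's pre-registered kill criterion (i)): K3Exhaustion (stmt-HodgeConjecture-11121, crux r4) refuted-substantive by Theorems.De (planner-rfix-HodgeConjecture-DerivedTorelliF-11b1dd57-0)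
- 2026-08-15T21:29:30Z · REPAIRED (restate FermatFourfoldsHC, FourfoldSectorComplement, ShiodaAokiSupply, Assembly; drop K3Exhaustion; add K3ExhaustionBelo) — back to open: repair (route-repair rfix; the route's pre-registered kill criterion (i)): K3Exhaustion (stmt-HodgeConjecture-11121, crux r4) refuted-substantive by Theorems.De (planner-rfix-HodgeConjecture-DerivedTorelliF-11b1dd57-0)
- 2026-08-15T23:15:08Z · rev 4: restated K3SectorAlgebraic (stmt-HodgeConjecture-11119), FermatFourfoldsHCModResidual (stmt-HodgeConjecture-13827), K3ExhaustionBelow110 (stmt-HodgeConjecture-13831) — route-choice (rchoice gen 1) after the SUBSTANTIVE refutation of K3Exhaustion (stmt-HodgeConjecture-11121, Theorems.DerivedTorelliFermatK3Exhaust (planner-rchoice-HodgeConjecture-DerivedTorelli-e5c17da6-0)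
- 2026-08-16T03:32:56Z · rev 5: restated FermatFourfoldsHCModResidual (stmt-HodgeConjecture-13928), K3SectorAlgebraic (stmt-HodgeConjecture-13927), Fermat33AccidentalClass (stmt-HodgeConjecture-11120), EigenspaceInputs (stmt-HodgeConjecture-11123), ShiodaAokiSupply (stmt-HodgeConjecture-13829), Assembly (stmt-HodgeConjecture-13830) — route-rep (planner-rbadge-HodgeConjecture-DerivedTorelliF-11b1dd57-0)
- 2026-08-16T03:45:48Z · rev 5: dropped stmt-HodgeConjecture-14236 — route-choice gen 1 reconciliation with the concurrent rbadge rev 5 (both seats answered the same target-unreachable hold): DROP my duplicate glue item stmt-Hodg (planner-rchoice-HodgeConjecture-DerivedTorelli-3bbfeca7-0)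
- 2026-08-16T03:59:29Z · rev 6: restated Assembly (stmt-HodgeConjecture-14581) — restate the Assembly item (stmt-HodgeConjecture-14581): its rev-5 form TargetGlue → HypersurfaceLefschetz → HodgeModels → EigenspaceInputs → ShiodaAokiSupply → (planner-rchoice-HodgeConjecture-DerivedTorelli-3bbfeca7-0)

sub-problem: HodgeConjecture · status: open · opened planner-plancard-HodgeConjecture-HodgeConject-f73ed4ab-0 2026-08-15T16:52:43Z · rev 7 · ledger route-HodgeConjecture-DerivedTorelliFermat
GENERATED by the gate from the ledger (D-0016/17). Provers cite these decls: `theorem foo : Summit.HodgeConjecture.HodgeConjecture.Theses.DerivedTorelliFermat.<Decl> := …` in Summits/HodgeConjecture/HodgeConjecture/Theorems/<Name>.lean.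
-/

namespace Summit.HodgeConjecture.HodgeConjecture.Theses.DerivedTorelliFermat

open scoped BigOperators Topology Manifold Classical MeasureTheory ProbabilityTheory Matrix InnerProductSpace ComplexConjugate ContinuousMap
open Filter Set Function TopologicalSpace MeasureTheory

attribute [summit_statement] _root_.HodgeConjecture

-- earlier FermatFourfoldsHCModResidual (stmt-HodgeConjecture-13827, replaced 2026-08-15T23:15:08Z -> stmt-HodgeConjecture-13928): retired by None — ∀ (m : ℕ) [NeZero m], (∀ α : Fin (2 * 2 + 2) → ZMod m, Literature.AlgebraicGeometry.HodgeTheory.FermatCharacter.IsHodge α → ¬ (∃ (Q : Multiset (ZMod m)) (parts : Multiset (Multiset (ZMod m))), (∀ κ ∈ parts, (Literature.AlgebraicGeometry.HodgeTheory.Ferma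
-- earlier FermatFourfoldsHCModResidual (stmt-HodgeConjecture-13928, replaced 2026-08-16T03:32:56Z -> stmt-HodgeConjecture-14576): retired by None — ∀ (m : ℕ) [NeZero m], (∀ α : Fin (2 * 2 + 2) → ZMod m, Literature.AlgebraicGeometry.HodgeTheory.FermatCharacter.IsHodge α → ¬ (∃ (Q : Multiset (ZMod m)) (parts : Multiset (Multiset (ZMod m))), (∀ κ ∈ parts, (Literature.AlgebraicGeometry.HodgeTheory.Ferma
/-- item stmt-HodgeConjecture-14576 · target · rank 0 · open · by planner
why it might fail: Instance family of HC: one non-algebraic eigenline V(α) with α Shioda–Aoki reachable or realisable-K3-sector — i.e. a refutation of Aoki's printed cycles/pullbacks (ShiodaAokiSupply) or of K3SectorAlgebraic (e.g. a non-norm multiplier at m = 33 with no similitude fallback) — refutes it and HC.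
sources: Shioda1979PJA, Shioda1979HodgeFermat, Aoki1987, arXiv:2101.04739, Summit.HodgeConjecture.HodgeConjecture.Theorems.DerivedTorelliFermatK3Exhaustion_refuted
[target] (rev 5 (route-repair 2026-08-16, cone hygiene only): V(α) ⊂ H⁴(V₊(Σxᵢᵐ)(ℂ);ℂ) is written
INLINE as the simultaneous eigenspace {c | g_a^* c = (∏ᵢ aᵢ^⟨αᵢ⟩)·c for every a ∈ (ℂˣ)⁶ with aᵢᵐ = 1
in diagonalStabilizer(Σxᵢᵐ)} = fermatEigenspace m α 4 (mem_fermatEigenspace_iff +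
fermatCharacter_apply; planner Bridge.lean memPred_iff) and the standard model as
SmoothHypersurface.hypersurface (fermatPolynomial ℂ 4 m) (= the abbrev fermatHypersurface 4 m);
EQUIVALENT to the rev-4 item stmt-HodgeConjecture-13928 by Bridge.lean target_iff; now CONCLUDED BY
the support item TargetGlue, proved by the planner in Bridge.lean targetGlue_holds) (rev 4: residual
= neither reachable nor REALISABLE-K3) for every degree m ≥ 1: IF the residual eigenlines of X⁴ₘ —
the V(α) with α a Hodge character whose multiset is neither Shioda–Aoki reachable (cancelling pairs
Q + (−Q) plus parts = Hodge multisets of cardinality ≤ 4, Hodge semi-decomposable sextuples, Aoki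
p-standard elements {a + k·d : k < p} + {−pa}, p | m an odd prime, d = m/p, 2·(a,d) < d) nor
realisable-K3-sector (as in K3SectorAlgebraic: K3-type β with unit orbit of size ≤ 21) — are
algebraic, THEN the Hodge conjecture holds for every smoo -/
@[route_item "route-HodgeConjecture-DerivedTorelliFermat"]
def FermatFourfoldsHCModResidual : Prop :=
  ∀ (m : ℕ) [NeZero m], (∀ α : Fin (2 * 2 + 2) → ZMod m, Literature.AlgebraicGeometry.HodgeTheory.FermatCharacter.IsHodge α → ¬ (∃ (Q : Multiset (ZMod m)) (parts : Multiset (Multiset (ZMod m))), (∀ κ ∈ parts, (Literature.AlgebraicGeometry.HodgeTheory.FermatCharacter.IsHodgeMultiset κ ∧ Multiset.card κ ≤ 4) ∨ (Literature.AlgebraicGeometry.HodgeTheory.FermatCharacter.IsHodgeMultiset κ ∧ Literature.AlgebraicGeometry.HodgeTheory.FermatCharacter.IsSemiDecomposable κ) ∨ (∃ (p r : ℕ) (a : ZMod m), p.Prime ∧ p = 2 * r + 1 ∧ p ∣ m ∧ 2 * Nat.gcd a.val (m / p) < m / p ∧ κ = (Multiset.range p).map (fun k : ℕ => a + (k : ZMod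 m) * ((m / p : ℕ) : ZMod m)) + {-((p : ZMod m) * a)})) ∧ Finset.univ.val.map α + (Q + Q.map fun a => -a) = parts.sum) → ¬ (∃ β γ : Fin 4 → ZMod m, ((∀ i, β i ≠ 0) ∧ ∑ i, β i = 0 ∧ ∃! δ : Fin 4 → ZMod m, (∃ t : (ZMod m)ˣ, δ = fun i => (t : ZMod m) * β i) ∧ Literature.AlgebraicGeometry.HodgeTheory.FermatCharacter.normSum δ = m) ∧ (∃ O : Finset (Fin 4 → ZMod m), O.card ≤ 21 ∧ ∀ t : (ZMod m)ˣ, (fun i => (t : ZMod m) * β i) ∈ O) ∧ β 3 + γ 3 = 0 ∧ Finset.univ.val.map α = ({β 0, β 1, β 2} + {γ 0, γ 1, γ 2} : Multiset (ZMod m))) → ∀ c : Literature.AlgebraicGeometry.HodgeTheory.complexBetti (Literature.AlgebraicGeometry.Motives.SmoothHypersurface.hypersurface (Literature.AlgebraicGeometry.Motives.fermatPolynomial ℂ (2 * 2) m)) (2 * 2), (∀ (a : Fin (2 * 2 + 2) → ℂˣ) (ha : a ∈ Literature.AlgebraicGeometry.HodgeTheory.diagonalStabilizer (Literature.AlgebraicGeometry.Motives.fermatPolynomial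 ℂ (2 * 2) m)), (∀ i, a i ^ m = 1) → Literature.AlgebraicTopology.SingularHomology.singularCohomology.map ℂ ℂ (Literature.AlgebraicGeometry.HodgeTheory.diagonalMap (Literature.AlgebraicGeometry.Motives.fermatPolynomial ℂ (2 * 2) m) ha) (2 * 2) c = (∏ i, (a i : ℂ) ^ (α i).val) • c) → c ∈ Literature.AlgebraicGeometry.HodgeTheory.algebraicClasses (Literature.AlgebraicGeometry.Motives.SmoothHypersurface.hypersurface (Literature.AlgebraicGeometry.Motives.fermatPolynomial ℂ (2 * 2) m)) 2) → ∀ (X : Literature.AlgebraicGeometry.Motives.SchemeOver ℂ), Literature.AlgebraicGeometry.Motives.IsFermatVariety 4 m X → Literature.AlgebraicGeometry.Motives.IsSmoothProjective 4 X → Literature.AlgebraicGeometry.HodgeTheory.HodgeConjectureFor 4 X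

-- earlier K3SectorAlgebraic (stmt-HodgeConjecture-11119, replaced 2026-08-15T23:15:08Z -> stmt-HodgeConjecture-13927): retired by None — ∀ (m : ℕ) [NeZero m] (α : Fin (2 * 2 + 2) → ZMod m), Literature.AlgebraicGeometry.HodgeTheory.FermatCharacter.IsHodge α → (∃ β γ : Fin 4 → ZMod m, ((∀ i, β i ≠ 0) ∧ ∑ i, β i = 0 ∧ ∃! δ : Fin 4 → ZMod m, (∃ t : (ZMod m)ˣ, δ = fun i => (t : ZMod m) * β i) ∧ Literatur
-- earlier K3SectorAlgebraic (stmt-HodgeConjecture-13927, replaced 2026-08-16T03:32:56Z -> stmt-HodgeConjecture-14577): retired by None — ∀ (m : ℕ) [NeZero m] (α : Fin (2 * 2 + 2) → ZMod m), Literature.AlgebraicGeometry.HodgeTheory.FermatCharacter.IsHodge α → (∃ β γ : Fin 4 → ZMod m, ((∀ i, β i ≠ 0) ∧ ∑ i, β i = 0 ∧ ∃! δ : Fin 4 → ZMod m, (∃ t : (ZMod m)ˣ, δ = fun i => (t : ZMod m) * β i) ∧ Literatur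
/-- item stmt-HodgeConjecture-14577 · crux · rank 2 · open · by planner
why it might fail: A Delsarte K3 realises ONE character orbit (LivneSchuttYui2010 Rem. 4) and φ(d′)=20 orbits (d′=33,44,50,66) need rank T(Y)=20, ρ(Y)=2: the partner orbit may have no ALGEBRAIC realisation V[γ] ≅ T(Y′)_ℚ; or the multiplier u ∉ ℚ>0·N(E×) (no isometry; only the KS-conditional Varesco Thm 5.3).
sources: Buskin2019, Huybrechts2019, Mukai1987ModuliBundlesK3, Shioda1986, LivneSchuttYui2010, Varesco2023
[crux] (rev 5 (route-repair 2026-08-16, cone hygiene only): V(α) ⊂ H⁴(V₊(Σxᵢᵐ)(ℂ);ℂ) is written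
INLINE as the simultaneous eigenspace {c | g_a^* c = (∏ᵢ aᵢ^⟨αᵢ⟩)·c for every a ∈ (ℂˣ)⁶ with aᵢᵐ = 1
in diagonalStabilizer(Σxᵢᵐ)} = fermatEigenspace m α 4 (mem_fermatEigenspace_iff +
fermatCharacter_apply; planner Bridge.lean memPred_iff) and the standard model as
SmoothHypersurface.hypersurface (fermatPolynomial ℂ 4 m) (= the abbrev fermatHypersurface 4 m);
EQUIVALENT to the rev-4 item stmt-HodgeConjecture-13927 by Bridge.lean k3Sector_iff — its vetting,
censuses and refuter notes carry over) (rev 4: K3-REALISABLE rank) for every m and every Hodge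
character α of X⁴ₘ in the realisable K3 sector — the multiset of α is {β₀,β₁,β₂} + {γ₀,γ₁,γ₂} with β
: Fin 4 → ℤ/m admissible (all βᵢ ≠ 0, Σβᵢ = 0), K3-TYPE (exactly one δ = t·β, t a unit, with Σ⟨δᵢ⟩ =
m, i.e. h²·⁰(V[β]) = 1), the unit orbit of β has at most 21 elements (rank V[β] = φ(d′) ≤ 21 = the
maximal rank of T(Y), Y a projective K3 surface; this cuts out exactly the φ = 24 K3-type orbits of
orders d′ ∈ {35, 45, 70, 90} found by refuter rattack-11119, which no K3 surface carries) and β₃ +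
γ₃ = 0 — the eigenline V(α) ⊂ H⁴(V₊(Σxᵢᵐ)(ℂ);ℂ) l -/
@[route_item "route-HodgeConjecture-DerivedTorelliFermat", crux]
def K3SectorAlgebraic : Prop :=
  ∀ (m : ℕ) [NeZero m] (α : Fin (2 * 2 + 2) → ZMod m), Literature.AlgebraicGeometry.HodgeTheory.FermatCharacter.IsHodge α → (∃ β γ : Fin 4 → ZMod m, ((∀ i, β i ≠ 0) ∧ ∑ i, β i = 0 ∧ ∃! δ : Fin 4 → ZMod m, (∃ t : (ZMod m)ˣ, δ = fun i => (t : ZMod m) * β i) ∧ Literature.AlgebraicGeometry.HodgeTheory.FermatCharacter.normSum δ = m) ∧ (∃ O : Finset (Fin 4 → ZMod m), O.card ≤ 21 ∧ ∀ t : (ZMod m)ˣ, (fun i => (t : ZMod m) * β i) ∈ O) ∧ β 3 + γ 3 = 0 ∧ Finset.univ.val.map α = ({β 0, β 1, β 2} + {γ 0, γ 1, γ 2} : Multiset (ZMod m))) → ∀ c : Literature.AlgebraicGeometry.HodgeTheory.complexBetti (Literature.AlgebraicGeometry.Motives.SmoothHypersurface.hypersurface (Literature.AlgebraicGeometry.Motives.fermatPolynomial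 ℂ (2 * 2) m)) (2 * 2), (∀ (a : Fin (2 * 2 + 2) → ℂˣ) (ha : a ∈ Literature.AlgebraicGeometry.HodgeTheory.diagonalStabilizer (Literature.AlgebraicGeometry.Motives.fermatPolynomial ℂ (2 * 2) m)), (∀ i, a i ^ m = 1) → Literature.AlgebraicTopology.SingularHomology.singularCohomology.map ℂ ℂ (Literature.AlgebraicGeometry.HodgeTheory.diagonalMap (Literature.AlgebraicGeometry.Motives.fermatPolynomial ℂ (2 * 2) m) ha) (2 * 2) c = (∏ i, (a i : ℂ) ^ (α i).val) • c) → c ∈ Literature.AlgebraicGeometry.HodgeTheory.algebraicClasses (Literature.AlgebraicGeometry.Motives.SmoothHypersurface.hypersurface (Literature.AlgebraicGeometry.Motives.fermatPolynomial ℂ (2 * 2) m)) 2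

-- earlier Fermat33AccidentalClass (stmt-HodgeConjecture-11120, replaced 2026-08-16T03:32:56Z -> stmt-HodgeConjecture-14578): retired by None — ∀ (α : Fin (2 * 2 + 2) → ZMod 33), Literature.AlgebraicGeometry.HodgeTheory.FermatCharacter.IsHodge α → (∃ t : (ZMod 33)ˣ, Finset.univ.val.map α = (({7, 10, 13, 19, 22, 28} : Multiset (ZMod 33)).map fun a => (t : ZMod 33) * a)) → Literature.AlgebraicGeometry.
/-- item stmt-HodgeConjecture-14578 · crux · rank 3 · open · by planner
why it might fail: If the cup-product forms Tr(λx ȳ) on the order-33 pieces [1,4,30,31], [1,12,22,31] have λ_β/λ_γ ∉ ℚ>0·N(ℚ(ζ₃₃)/ℚ(ζ₃₃)⁺), no Hodge isometry exists: Buskin / Huybrechts Rem. 3.3 are silent and a mere similarity is algebraic only under the Kuga–Satake Hodge conjecture (Varesco Thm 5.3).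
sources: arXiv:2101.04739, Buskin2019, Huybrechts2019, Varesco2023, arXiv:0904.1922
[crux] (rev 5 (route-repair 2026-08-16, cone hygiene only): V(α) ⊂ H⁴(V₊(Σxᵢᵐ)(ℂ);ℂ) is written
INLINE as the simultaneous eigenspace {c | g_a^* c = (∏ᵢ aᵢ^⟨αᵢ⟩)·c for every a ∈ (ℂˣ)⁶ with aᵢᵐ = 1
in diagonalStabilizer(Σxᵢᵐ)} = fermatEigenspace m α 4 (mem_fermatEigenspace_iff +
fermatCharacter_apply; planner Bridge.lean memPred_iff) and the standard model as
SmoothHypersurface.hypersurface (fermatPolynomial ℂ 4 m) (= the abbrev fermatHypersurface 4 m);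
EQUIVALENT to the rev-4 item stmt-HodgeConjecture-11120 by Bridge.lean fermat33_iff — the POSITIVE
norm-class test (refuter rattack-11120) and all notes on stmt-HodgeConjecture-11120 carry over) on
the Fermat fourfold of degree 33 the eigenlines V(α) for α in the unit class of da Silva's
non-quasi-decomposable character (7,10,13,19,22,28) (4 multisets; Prop. 3.6 of arXiv:2101.04739) are
algebraic. Census facts (calc/splits.py): these are the ONLY length-3 elements of M₃₃ outside the
Shioda–Aoki supply (checked with ≤ 5 added pairs), and each of their five K3 splits pairs the two
inequivalent order-33 K3-type orbits [1,4,30,31] and [1,12,22,31] of S₃₃ — the class is the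
accidental Hodge isomorphism V[(1,4,30,31)] ≅ V[(1,12,22,31)] (ra -/
@[route_item "route-HodgeConjecture-DerivedTorelliFermat"]
def Fermat33AccidentalClass : Prop :=
  ∀ (α : Fin (2 * 2 + 2) → ZMod 33), Literature.AlgebraicGeometry.HodgeTheory.FermatCharacter.IsHodge α → (∃ t : (ZMod 33)ˣ, Finset.univ.val.map α = (({7, 10, 13, 19, 22, 28} : Multiset (ZMod 33)).map fun a => (t : ZMod 33) * a)) → ∀ c : Literature.AlgebraicGeometry.HodgeTheory.complexBetti (Literature.AlgebraicGeometry.Motives.SmoothHypersurface.hypersurface (Literature.AlgebraicGeometry.Motives.fermatPolynomial ℂ (2 * 2) 33)) (2 * 2), (∀ (a : Fin (2 * 2 + 2) → ℂˣ) (ha : a ∈ Literature.AlgebraicGeometry.HodgeTheory.diagonalStabilizer (Literature.AlgebraicGeometry.Motives.fermatPolynomial ℂ (2 * 2) 33)), (∀ i, a i ^ 33 = 1) → Literature.AlgebraicTopology.SingularHomology.singularCohomology.map ℂ ℂ (Literature.AlgebraicGeometry.HodgeTheory.diagonalMap (Literature.AlgebraicGeometry.Motives.fermatPolynomial ℂ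 (2 * 2) 33) ha) (2 * 2) c = (∏ i, (a i : ℂ) ^ (α i).val) • c) → c ∈ Literature.AlgebraicGeometry.HodgeTheory.algebraicClasses (Literature.AlgebraicGeometry.Motives.SmoothHypersurface.hypersurface (Literature.AlgebraicGeometry.Motives.fermatPolynomial ℂ (2 * 2) 33)) 2

/-- item stmt-HodgeConjecture-13828 · crux · rank 9 · open · by planner
why it might fail: It IS the Hodge conjecture off the route's sector (every non-Fermat variety, plus the residual Fermat eigenlines at m = 70, 110, 114, …): open, declared and NOT claimed; any counterexample to HC anywhere refutes it — conjecture-grade, rank 9 keeps it unstaffed.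
sources: Deligne2000, arXiv:2502.03415, arXiv:2509.23403, Summit.HodgeConjecture.HodgeConjecture.Theses.KugaSatakeSaturation.SectorComplement
[support] (bookkeeping, NOT claimed) the complement of the route's sector: the repaired target (HC
for Fermat fourfolds modulo their residual eigenlines) implies HC. It exists so that the deciding
theorem concludes the sub-problem Statement by name (declared sector route). Besides HC off the
Fermat fourfolds it now contains the RESIDUAL SECTOR named by the refutation of K3Exhaustion: the
eigenlines V(α) of X⁴ₘ with α neither Shioda–Aoki reachable nor K3-sector — none for m ≤ 109; m =
110: unit orbits of {1,24,62,71,81,91} and {1,31,55,71,81,91} (certified unreachable for any added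
pairs by the odd invariant ψ = ±1 on ±{9,13,18,26,29,37}; every 3+3 split pairs CM pieces of
H²(S₁₁₀) with h²·⁰ = 2); m = 114: {1,7,78,79,86,91}, {1,13,43,72,103,110}, {1,13,43,80,102,103} —
accidental Hodge morphisms of higher genus (da Silva's 'candidates for a counter-example'), for
which no Mukai/Buskin/Huybrechts theorem exists; by André's CM remark they are sums of pullbacks of
Weil classes on CM abelian varieties of Weil type with K ⊂ ℚ(ζₘ), where Markman's secant-sheaf
engine is unconditional only for sixfolds of split Weil type (arXiv:2502.03415, arXiv:2509.23403).
Nobody is asked to prove this i -/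
@[route_item "route-HodgeConjecture-DerivedTorelliFermat", crux]
def ResidualSectorComplement : Prop :=
  FermatFourfoldsHCModResidual → _root_.HodgeConjecture

/-- item stmt-HodgeConjecture-11125 · support · rank 9 · open · by planner
sources: arXiv:2101.04739, Shioda1979PJA
[support] (milestone, new theorem if reached) the Hodge conjecture for the smooth projective Fermat
fourfold of degree 33 — from Fermat33AccidentalClass, ShiodaAokiSupply at m = 33, the m = 33 case of
K3Exhaustion (a finite certified computation: 990 Hodge multisets), EigenspaceInputs,
HypersurfaceLefschetz, HodgeModels, by the same transport as the route's closes. [difficulty: L] -/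
@[route_item "route-HodgeConjecture-DerivedTorelliFermat"]
def FermatFourfoldThirtyThree : Prop :=
  ∀ (X : Literature.AlgebraicGeometry.Motives.SchemeOver ℂ), Literature.AlgebraicGeometry.Motives.IsFermatVariety 4 33 X → Literature.AlgebraicGeometry.Motives.IsSmoothProjective 4 X → Literature.AlgebraicGeometry.HodgeTheory.HodgeConjectureFor 4 X

-- earlier HypersurfaceLefschetz (stmt-HodgeConjecture-11124, replaced 2026-08-15T16:56:22Z -> stmt-HodgeConjecture-11281): retired by None — Literature.AlgebraicGeometry.HodgeTheory.Voisin2003_smoothHypersurface_algebraicClasses_eq_top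
/-- item stmt-HodgeConjecture-11281 · support · rank 9 · closed · proved by Summit.HodgeConjecture.HodgeConjecture.Theorems.derivedTorelliFermat_hypersurfaceLefschetz_proof @ f279bb5ba6f4 (prover) · by planner
sources: VoisinHodgeII2003
[support] (known theorem; cone hygiene) Lefschetz off the middle degree for smooth hypersurfaces Y ⊂
ℙⁿ⁺¹_ℂ: for 0 < p < n, 2p ≠ n, algebraicClasses Y p = ⊤ (VoisinHodgeII2003 Cor. 1.24–1.25: Lefschetz
hyperplane theorem + hard Lefschetz). This is VERBATIM the body of the tree's named fact
Literature.AlgebraicGeometry.HodgeTheory.Voisin2003_smoothHypersurface_algebraicClasses_eq_top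
(Iff.rfl), restated inline because that fact is currently cite_only: it closes by `fun n d Y hY p h0
hn h2 => Voisin2003_… hY p h0 hn h2` the moment the fact is READ-verified / vendored, or by a direct
proof. Sources: VoisinHodgeII2003. -/
@[route_item "route-HodgeConjecture-DerivedTorelliFermat", crux]
def HypersurfaceLefschetz : Prop :=
  ∀ ⦃n d : ℕ⦄ ⦃Y : Literature.AlgebraicGeometry.Motives.SchemeOver ℂ⦄, Literature.AlgebraicGeometry.Motives.IsSmoothHypersurface n d Y → ∀ p : ℕ, 0 < p → p < n → 2 * p ≠ n → Literature.AlgebraicGeometry.HodgeTheory.algebraicClasses Y p = ⊤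

/-- item stmt-HodgeConjecture-13929 · support · rank 9 · open · by planner
why it might fail: Census-only (two independent exact lattice censuses: planner calc/census.py m ≤ 112, refuter g46-1): a guard/part-list mismatch with the typed clauses or an orbit-size slip at some m ≤ 109 refutes it — repair = add the exception; the glue does not use this item.
sources: Aoki1987, arXiv:2101.04739, Shioda1979PJA, Summit.HodgeConjecture.HodgeConjecture.Theorems.DerivedTorelliFermatK3Exhaustion_refuted
[support] (NEW rev 4; finite certified computation; replaces K3ExhaustionBelow110, which stays TRUE
as typed but is superseded) the EXACT residual census below 110: for every m < 110 every Hodge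
multiset s of cardinality 6 in ℤ/m (= Hodge character of X⁴ₘ up to permutation) is either
SHIODA–AOKI REACHABLE — s + (Q + (−Q)) = Σ parts for some multiset Q, each part a Hodge multiset of
cardinality ≤ 4, a Hodge semi-decomposable sextuple, or an Aoki p-standard element {a + k·d : k < p}
+ {−pa} (p | m odd prime, d = m/p, 2·(a,d) < d) — or REALISABLE-K3-SECTOR (as in K3SectorAlgebraic:
K3-type β with unit orbit of size ≤ 21) — or m = 70 and s is a unit multiple of {1,20,24,42,61,62}.
Evidence: planner calc/census.py + calc/census_4_120.txt (pure python, exact: the part list is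
negation-closed, so reachability for SOME Q = membership of the class of s in the ℤ-span of the part
classes in ℤ^{⌊(m−1)/2⌋} (× ℤ/2 for even m), decided by incremental Hermite reduction; Hodge
sextuples enumerated exhaustively; K3 clause literal incl. orbit sizes): unreachable sextuples for 4
≤ m ≤ 109 occur only at m = 33 (4; K3 splits of orbit size 20), m = 70 (24 = exactly the unit orbit
of {1,20,24,42,61,62}; a -/
@[route_item "route-HodgeConjecture-DerivedTorelliFermat"]
def ResidualCensusBelow110 : Prop :=
  ∀ (m : ℕ) [NeZero m], m < 110 → ∀ s : Multiset (ZMod m), Literature.AlgebraicGeometry.HodgeTheory.FermatCharacter.IsHodgeMultiset s → Multiset.card s = 6 → (∃ (Q : Multiset (ZMod m)) (parts : Multiset (Multiset (ZMod m))), (∀ κ ∈ parts, (Literature.AlgebraicGeometry.HodgeTheory.FermatCharacter.IsHodgeMultiset κ ∧ Multiset.card κ ≤ 4) ∨ (Literature.AlgebraicGeometry.HodgeTheory.FermatCharacter.IsHodgeMultiset κ ∧ Literature.AlgebraicGeometry.HodgeTheory.FermatCharacter.IsSemiDecomposable κ) ∨ (∃ (p r : ℕ) (a : ZMod m), p.Prime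 ∧ p = 2 * r + 1 ∧ p ∣ m ∧ 2 * Nat.gcd a.val (m / p) < m / p ∧ κ = (Multiset.range p).map (fun k : ℕ => a + (k : ZMod m) * ((m / p : ℕ) : ZMod m)) + {-((p : ZMod m) * a)})) ∧ s + (Q + Q.map fun a => -a) = parts.sum) ∨ (∃ β γ : Fin 4 → ZMod m, ((∀ i, β i ≠ 0) ∧ ∑ i, β i = 0 ∧ ∃! δ : Fin 4 → ZMod m, (∃ t : (ZMod m)ˣ, δ = fun i => (t : ZMod m) * β i) ∧ Literature.AlgebraicGeometry.HodgeTheory.FermatCharacter.normSum δ = m) ∧ (∃ O : Finset (Fin 4 → ZMod m), O.card ≤ 21 ∧ ∀ t : (ZMod m)ˣ, (fun i => (t : ZMod m) * β i) ∈ O) ∧ β 3 + γ 3 = 0 ∧ s = ({β 0, β 1, β 2} + {γ 0, γ 1, γ 2} : Multiset (ZMod m))) ∨ (m = 70 ∧ ∃ t : (ZMod m)ˣ, s = (({1, 20, 24, 42, 61, 62} : Multiset (ZMod m)).map fun a => (t : ZMod m) * a))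

/-- item stmt-HodgeConjecture-14298 · support · rank 9 · closed · proved by Summit.HodgeConjecture.HodgeConjecture.Theorems.derivedTorelliFermat_thirtyThreeGlue_proof @ f34de659c9ff (prover) · by planner
[support] GLUE to the milestone (route-choice gen 1, 2026-08-16; makes FermatFourfoldThirtyThree
reachable from items): the target plus the residual census below 110 give the Hodge conjecture for
every smooth projective Fermat fourfold of degree 33. ALREADY PROVED: planner Sketch.lean
`thirtyThreeGlue_holds` (lean check rc 0, 0 sorries): instantiate the target at m = 33; its residual
hypothesis hR is VACUOUS because 33 < 110 and 33 ≠ 70, so by ResidualCensusBelow110 every Hodge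
character α of X⁴₃₃ (IsHodge.isHodgeMultiset, card (univ.val.map α) = 6 by simp) is Shioda–Aoki
reachable or realisable-K3-sector — the third alternative `m = 70 ∧ …` is absurd by norm_num. Eight
tactic lines; a prover lands it as Theorems/DerivedTorelliFermatThirtyThreeGlue.lean (difficulty S).
Combined with TargetGlue: FermatFourfoldThirtyThree follows from HypersurfaceLefschetz, HodgeModels,
EigenspaceInputs, ShiodaAokiSupply, K3SectorAlgebraic, ResidualCensusBelow110 (Sketch.lean
thirtyThree_of_items); the sharper derivation from Fermat33AccidentalClass alone needs the m = 33
census clause 'unreachable ⇒ unit multiple of {7,10,13,19,22,28}' and is left to the two-layer plan.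
Why it might fail: it cannot -/
@[route_item "route-HodgeConjecture-DerivedTorelliFermat"]
def ThirtyThreeGlue : Prop :=
  FermatFourfoldsHCModResidual → ResidualCensusBelow110 → FermatFourfoldThirtyThree

-- earlier EigenspaceInputs (stmt-HodgeConjecture-11123, replaced 2026-08-16T03:32:56Z -> stmt-HodgeConjecture-14579): retired by None — ∀ (m : ℕ) [NeZero m], (∀ α : Fin (2 * 2 + 2) → ZMod m, α ≠ 0 → (∃ i, α i = 0) → Literature.AlgebraicGeometry.HodgeTheory.fermatEigenspace m α (2 * 2) = ⊥) ∧ (Literature.AlgebraicGeometry.HodgeTheory.fermatEigenspace m (0 : Fin (2 * 2 + 2) → ZMod m) (2 * 2) ≤ LinearM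
/-- item stmt-HodgeConjecture-14579 · support · rank 9 · open · by planner
sources: Ran1980, Shioda1979HodgeFermat, Shioda1979PJA
[support] (rev 5 (route-repair 2026-08-16, cone hygiene only): V(α) ⊂ H⁴(V₊(Σxᵢᵐ)(ℂ);ℂ) is written
INLINE as the simultaneous eigenspace {c | g_a^* c = (∏ᵢ aᵢ^⟨αᵢ⟩)·c for every a ∈ (ℂˣ)⁶ with aᵢᵐ = 1
in diagonalStabilizer(Σxᵢᵐ)} = fermatEigenspace m α 4 (mem_fermatEigenspace_iff +
fermatCharacter_apply; planner Bridge.lean memPred_iff) and the standard model as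
SmoothHypersurface.hypersurface (fermatPolynomial ℂ 4 m) (= the abbrev fermatHypersurface 4 m);
EQUIVALENT to the rev-4 item stmt-HodgeConjecture-11123 by Bridge.lean eigenspaceInputs_iff; the
prover converts back with memPred_iff and uses the tree's fermatEigenspace API) (known; Ran1980
Prop. 1.7 (i)–(ii), Shioda1979HodgeFermat (1.7) and Hⁿ(Xⁿₘ)^G = Hⁿ(ℙⁿ)) the three eigenspace inputs
hE2, hE0, hE4 of the tree theorem mem_algebraicClasses_fermat_middle_of_eigenspaces at p = 2, for
every m ≥ 1: V(α) ∩ H⁴ = 0 for α ≠ 0 with a zero coordinate; V(0) ∩ H⁴ is restricted from ℙ⁵; a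
character all of whose coordinates are non-zero carrying a non-zero class of type (2,2) has 2Σ⟨βᵢ⟩ =
6m. Shared need of the named fact hodgeClasses_algebraic_fermat. [difficulty: L] -/
@[route_item "route-HodgeConjecture-DerivedTorelliFermat", crux]
def EigenspaceInputs : Prop :=
  ∀ (m : ℕ) [NeZero m], (∀ α : Fin (2 * 2 + 2) → ZMod m, α ≠ 0 → (∃ i, α i = 0) → ∀ c : Literature.AlgebraicGeometry.HodgeTheory.complexBetti (Literature.AlgebraicGeometry.Motives.SmoothHypersurface.hypersurface (Literature.AlgebraicGeometry.Motives.fermatPolynomial ℂ (2 * 2) m)) (2 * 2), (∀ (a : Fin (2 * 2 + 2) → ℂˣ) (ha : a ∈ Literature.AlgebraicGeometry.HodgeTheory.diagonalStabilizer (Literature.AlgebraicGeometry.Motives.fermatPolynomial ℂ (2 * 2) m)), (∀ i, a i ^ m = 1) → Literature.AlgebraicTopology.SingularHomology.singularCohomology.map ℂ ℂ (Literature.AlgebraicGeometry.HodgeTheory.diagonalMap (Literature.AlgebraicGeometry.Motives.fermatPolynomial ℂ (2 * 2) m) ha) (2 * 2) c = (∏ i, (a i : ℂ) ^ (α i).val)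 • c) → c = 0) ∧ (∀ c : Literature.AlgebraicGeometry.HodgeTheory.complexBetti (Literature.AlgebraicGeometry.Motives.SmoothHypersurface.hypersurface (Literature.AlgebraicGeometry.Motives.fermatPolynomial ℂ (2 * 2) m)) (2 * 2), (∀ (a : Fin (2 * 2 + 2) → ℂˣ) (ha : a ∈ Literature.AlgebraicGeometry.HodgeTheory.diagonalStabilizer (Literature.AlgebraicGeometry.Motives.fermatPolynomial ℂ (2 * 2) m)), (∀ i, a i ^ m = 1) → Literature.AlgebraicTopology.SingularHomology.singularCohomology.map ℂ ℂ (Literature.AlgebraicGeometry.HodgeTheory.diagonalMap (Literature.AlgebraicGeometry.Motives.fermatPolynomial ℂ (2 * 2) m) ha) (2 * 2) c = (∏ i, (a i : ℂ) ^ ((0 : Fin (2 * 2 + 2) → ZMod m) i).val) • c) → c ∈ LinearMap.range (Literature.AlgebraicGeometry.HodgeTheory.complexBetti.map (Literature.AlgebraicGeometry.Motives.SmoothHypersurface.hypersurfaceι (Literature.AlgebraicGeometry.Motives.fermatPolynomial ℂ (2 * 2) m)) (2 * 2)).hom) ∧ (∀ (A : Literature.AlgebraicGeometry.HodgeTheory.HodgeModel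 (2 * 2) (Literature.AlgebraicGeometry.Motives.SmoothHypersurface.hypersurface (Literature.AlgebraicGeometry.Motives.fermatPolynomial ℂ (2 * 2) m))) (β : Fin (2 * 2 + 2) → ZMod m), (∀ i, β i ≠ 0) → (∃ x : Literature.AlgebraicGeometry.HodgeTheory.complexBetti (Literature.AlgebraicGeometry.Motives.SmoothHypersurface.hypersurface (Literature.AlgebraicGeometry.Motives.fermatPolynomial ℂ (2 * 2) m)) (2 * 2), (∀ (a : Fin (2 * 2 + 2) → ℂˣ) (ha : a ∈ Literature.AlgebraicGeometry.HodgeTheory.diagonalStabilizer (Literature.AlgebraicGeometry.Motives.fermatPolynomial ℂ (2 * 2) m)), (∀ i, a i ^ m = 1) → Literature.AlgebraicTopology.SingularHomology.singularCohomology.map ℂ ℂ (Literature.AlgebraicGeometry.HodgeTheory.diagonalMap (Literature.AlgebraicGeometry.Motives.fermatPolynomial ℂ (2 * 2) m) ha) (2 * 2) x = (∏ i, (a i : ℂ) ^ (β i).val) • x) ∧ x ≠ 0 ∧ A.pullback (2 * 2) x ∈ A.hodgePQ (2 * 2) 2 2) → 2 * Literature.AlgebraicGeometry.HodgeTheory.FermatCharacter.normSum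 β = m * (2 * 2 + 2))

-- earlier ShiodaAokiSupply (stmt-HodgeConjecture-11122, replaced 2026-08-15T21:29:30Z -> stmt-HodgeConjecture-13829): retired by None — ∀ (m : ℕ) [NeZero m] (α : Fin (2 * 2 + 2) → ZMod m), Literature.AlgebraicGeometry.HodgeTheory.FermatCharacter.IsHodge α → (∃ (Q : Multiset (ZMod m)) (parts : Multiset (Multiset (ZMod m))), (∀ κ ∈ parts, (Literature.AlgebraicGeometry.HodgeTheory.FermatCharacter.IsHod
-- earlier ShiodaAokiSupply (stmt-HodgeConjecture-13829, replaced 2026-08-16T03:32:56Z -> stmt-HodgeConjecture-14580): retired by None — ∀ (m : ℕ) [NeZero m] (α : Fin (2 * 2 + 2) → ZMod m), Literature.AlgebraicGeometry.HodgeTheory.FermatCharacter.IsHodge α → (∃ (Q : Multiset (ZMod m)) (parts : Multiset (Multiset (ZMod m))), (∀ κ ∈ parts, (Literature.AlgebraicGeometry.HodgeTheory.FermatCharacter.IsHod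
/-- item stmt-HodgeConjecture-14580 · support · rank 9 · open · by planner
sources: Shioda1979HodgeFermat, Shioda1979PJA, Aoki1987, Ran1980, ShiodaKatsura1979, arXiv:2101.04739
[support] (rev 5 (route-repair 2026-08-16, cone hygiene only): V(α) ⊂ H⁴(V₊(Σxᵢᵐ)(ℂ);ℂ) is written
INLINE as the simultaneous eigenspace {c | g_a^* c = (∏ᵢ aᵢ^⟨αᵢ⟩)·c for every a ∈ (ℂˣ)⁶ with aᵢᵐ = 1
in diagonalStabilizer(Σxᵢᵐ)} = fermatEigenspace m α 4 (mem_fermatEigenspace_iff +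
fermatCharacter_apply; planner Bridge.lean memPred_iff) and the standard model as
SmoothHypersurface.hypersurface (fermatPolynomial ℂ 4 m) (= the abbrev fermatHypersurface 4 m);
EQUIVALENT to the rev-4 item stmt-HodgeConjecture-13829 by Bridge.lean supply_iff) (known in print;
formalisation debt; rev 3: the 5-standard clause restated as Aoki's p-standard elements under the
PRINTED guard) for every Hodge character α of X⁴ₘ whose multiset is Shioda–Aoki reachable — univ.map
α + (Q + (−Q)) = Σ parts, each part a Hodge multiset of cardinality ≤ 4 (pairs; Fermat-surface
characters), a Hodge semi-decomposable sextuple (Cₘ × Cₘ), or an Aoki p-standard element {a + k·d :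
k < p} + {−pa} with p | m an odd prime, d = m/p and 2·(a,d) < d (Aoki's standing condition d/(a,d) >
2, p. 387; verbatim the multiset of the tree fact Aoki1987_claim_pStandard) — V(α) consists of
algebraic classes: Lefschetz (1,1) on X²ₘ and on X -/
@[route_item "route-HodgeConjecture-DerivedTorelliFermat", crux]
def ShiodaAokiSupply : Prop :=
  ∀ (m : ℕ) [NeZero m] (α : Fin (2 * 2 + 2) → ZMod m), Literature.AlgebraicGeometry.HodgeTheory.FermatCharacter.IsHodge α → (∃ (Q : Multiset (ZMod m)) (parts : Multiset (Multiset (ZMod m))), (∀ κ ∈ parts, (Literature.AlgebraicGeometry.HodgeTheory.FermatCharacter.IsHodgeMultiset κ ∧ Multiset.card κ ≤ 4) ∨ (Literature.AlgebraicGeometry.HodgeTheory.FermatCharacter.IsHodgeMultiset κ ∧ Literature.AlgebraicGeometry.HodgeTheory.FermatCharacter.IsSemiDecomposable κ) ∨ (∃ (p r : ℕ) (a : ZMod m), p.Prime ∧ p = 2 * r + 1 ∧ p ∣ m ∧ 2 * Nat.gcd a.val (m / p) < m / p ∧ κ = (Multiset.range p).map (fun k : ℕ => a + (k : ZMod m)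 * ((m / p : ℕ) : ZMod m)) + {-((p : ZMod m) * a)})) ∧ Finset.univ.val.map α + (Q + Q.map fun a => -a) = parts.sum) → ∀ c : Literature.AlgebraicGeometry.HodgeTheory.complexBetti (Literature.AlgebraicGeometry.Motives.SmoothHypersurface.hypersurface (Literature.AlgebraicGeometry.Motives.fermatPolynomial ℂ (2 * 2) m)) (2 * 2), (∀ (a : Fin (2 * 2 + 2) → ℂˣ) (ha : a ∈ Literature.AlgebraicGeometry.HodgeTheory.diagonalStabilizer (Literature.AlgebraicGeometry.Motives.fermatPolynomial ℂ (2 * 2) m)), (∀ i, a i ^ m = 1) → Literature.AlgebraicTopology.SingularHomology.singularCohomology.map ℂ ℂ (Literature.AlgebraicGeometry.HodgeTheory.diagonalMap (Literature.AlgebraicGeometry.Motives.fermatPolynomial ℂ (2 * 2) m) ha) (2 * 2) c = (∏ i, (a i : ℂ) ^ (α i).val) • c) → c ∈ Literature.AlgebraicGeometry.HodgeTheory.algebraicClasses (Literature.AlgebraicGeometry.Motives.SmoothHypersurface.hypersurface (Literature.AlgebraicGeometry.Motives.fermatPolynomial ℂ (2 * 2) m)) 2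

/-- item stmt-HodgeConjecture-1943 · support · rank 9 · closed · proved by Summit.HodgeConjecture.HodgeConjecture.Theorems.nodalSupport_hodgeModels_proof @ 6468568b8792 (prover) · by planner
sources: SerreGAGA1956, VoisinHodgeI2002
[support] needs-fact: Literature.AlgebraicGeometry.HodgeTheory.nonempty_hodgeModel (route-repair,
cone guardrail 2026-08-15). GENUINELY needed: `Nonempty (HodgeModel n X)` is conjunct 1 of
HodgeTheory.HodgeConjectureFor, i.e. part of the summit statement itself, so every route to
HodgeConjecture must produce it. This decl is VERBATIM the first antecedent of this route's Assembly
(and of NodalSupport's and QbarEnvelope's — re-ask this exact signature there to share the item); it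
is filed as an item so that the closing chain is items-only (`Assembly_holds HodgeModels_holds
IsoInvariance_holds VariationalHodge_holds AnchorExistence_holds : HodgeConjecture` typechecks with
no unfolding; planner Sketch.lean rc 0, where `HodgeModels ↔ ∀ n X, IsSmoothProjective n X →
Nonempty (HodgeModel n X)` is Iff.rfl) and so that the fact is named in the ledger as tier-0 debt of
the summit. HOW IT CLOSES: one line, `fun n X => nonempty_hodgeModel_holds`, once the Literature
fact is discharged — the reduction is already in tree:
HodgeModelExistenceDischarge.nonempty_hodgeModel_of_deRham_of_hodgeDecomposition (remaining leaves:
the real de Rham theorem exists_deRhamIsoFamily and the Hodge decomposition -/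
@[route_item "route-HodgeConjecture-DerivedTorelliFermat", crux]
def HodgeModels : Prop :=
  ∀ (n : ℕ) (X : Literature.AlgebraicGeometry.Motives.SchemeOver ℂ), Literature.AlgebraicGeometry.HodgeTheory.nonempty_hodgeModel n X

/-- `HodgeModels` holds: proved by `Summit.HodgeConjecture.HodgeConjecture.Theorems.nodalSupport_hodgeModels_proof` @ 6468568b8792. -/
theorem HodgeModels_holds : HodgeModels := _root_.Summit.HodgeConjecture.HodgeConjecture.Theorems.nodalSupport_hodgeModels_proof

/-- item stmt-HodgeConjecture-14582 · support · rank 10 · closed · proved by Summit.HodgeConjecture.HodgeConjecture.Theorems.derivedTorelliFermat_targetGlue_proof @ 708a929c2202 (prover) · by planner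
sources: Shioda1979PJA, Ran1980, VoisinHodgeII2003
[support] (NEW rev 5; glue, filed at rank 10 so that the gate renders it after the rank-9 supports
it names (supports render by rank, then item id; the shared HodgeModels stmt-HodgeConjecture-1943
sorts last among rank 9) — answers the badge finding 'no item concludes the target
FermatFourfoldsHCModResidual'; PROVED by the planner: Bridge.lean `targetGlue_holds`, 0 sorries,
axioms propext/Classical.choice/Quot.sound, attached as evidence — a prover closes the item by
copying that proof into Summits/HodgeConjecture/HodgeConjecture/Theorems/, importing
Literature.AlgebraicGeometry.HodgeTheory.FermatHodgeConjectureAssembly there, where heavy imports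
are harmless) the rev-4 deciding theorem minus its NOT-claimed frame: from Lefschetz off the middle
degree (HypersurfaceLefschetz), Hodge models (HodgeModels), the three eigenspace inputs
(EigenspaceInputs), the Shioda–Aoki supply (ShiodaAokiSupply) and the realisable K3 sector
(K3SectorAlgebraic) follows the target FermatFourfoldsHCModResidual. Proof (Bridge.lean
old_target_of + the *_iff bridges): for a Fermat fourfold X of degree m ≥ 1 whose residual
eigenlines are algebraic (the target's hypothesis hR) the model conjunct is hM 4 X; off -/
@[route_item "route-HodgeConjecture-DerivedTorelliFermat", crux]
def TargetGlue : Prop :=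
  HypersurfaceLefschetz → HodgeModels → EigenspaceInputs → ShiodaAokiSupply → K3SectorAlgebraic → FermatFourfoldsHCModResidual

-- earlier Assembly (stmt-HodgeConjecture-11127, replaced 2026-08-15T21:29:30Z -> stmt-HodgeConjecture-13830): retired by None — HypersurfaceLefschetz → HodgeModels → EigenspaceInputs → ShiodaAokiSupply → K3SectorAlgebraic → K3Exhaustion → FourfoldSectorComplement → _root_.HodgeConjecture
-- earlier Assembly (stmt-HodgeConjecture-13830, replaced 2026-08-16T03:32:56Z -> stmt-HodgeConjecture-14581): retired by None — HypersurfaceLefschetz → HodgeModels → EigenspaceInputs → ShiodaAokiSupply → K3SectorAlgebraic → ResidualSectorComplement → _root_.HodgeConjecture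
-- earlier Assembly (stmt-HodgeConjecture-14581, replaced 2026-08-16T03:59:29Z -> stmt-HodgeConjecture-14588): retired by None — TargetGlue → HypersurfaceLefschetz → HodgeModels → EigenspaceInputs → ShiodaAokiSupply → K3SectorAlgebraic → ResidualSectorComplement → _root_.HodgeConjecture
/-- item stmt-HodgeConjecture-14588 · assembly · rank 1 · closed · proved by Summit.HodgeConjecture.HodgeConjecture.Theorems.derivedTorelliFermat_assembly_proof @ beb27f7d83b7 (prover) · by planner
sources: Shioda1979PJA, Aoki1987
[assembly] (rev 5b, planner route-choice gen 1) HypersurfaceLefschetz → HodgeModels →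
EigenspaceInputs → ShiodaAokiSupply → K3SectorAlgebraic → ResidualSectorComplement → the sub-problem
statement — the deciding chain with the glue item TargetGlue DISCHARGED (closes is `hC (hT hL hM hE
hS hK)`; this item is `fun hL hM hE hS hK hC => hC (targetGlue hL hM hE hS hK)` as soon as
TargetGlue = stmt-HodgeConjecture-14582 is landed in Theorems from the proof attached to it —
difficulty S after that). Same text as the rev-3/4 Assembly (stmt-HodgeConjecture-13830); the rev-5
variant with TargetGlue as an extra antecedent was a propositional tautology (ground.trivial by
`intros; aesop`) and is retired by this restatement. Sources: Shioda1979PJA, Aoki1987. -/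
@[route_item "route-HodgeConjecture-DerivedTorelliFermat"]
def Assembly : Prop :=
  HypersurfaceLefschetz → HodgeModels → EigenspaceInputs → ShiodaAokiSupply → K3SectorAlgebraic → ResidualSectorComplement → _root_.HodgeConjecture

-- records of items no longer active in this route (dropped / restated):
-- earlier FermatFourfoldsHC (stmt-HodgeConjecture-11118, replaced 2026-08-15T21:29:30Z -> stmt-HodgeConjecture-13827): retired by None — ∀ (m : ℕ) (X : Literature.AlgebraicGeometry.Motives.SchemeOver ℂ), 0 < m → Literature.AlgebraicGeometry.Motives.IsFermatVariety 4 m X → Literature.AlgebraicGeometry.Motives.IsSmoothProjective 4 X → Literature.AlgebraicGeometry.HodgeTheory.HodgeConjectureFor 4 X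
-- earlier K3Exhaustion (stmt-HodgeConjecture-11121, dropped 2026-08-15T21:29:30Z): refuted by Summit.HodgeConjecture.HodgeConjecture.Theorems.DerivedTorelliFermatK3Exhaustion_refuted @ cab5fce94e33 — ∀ (m : ℕ) [NeZero m] (s : Multiset (ZMod m)), Literature.AlgebraicGeometry.HodgeTheory.FermatCharacter.IsHodgeMultiset s → Multiset.card s = 6 → (∃ (Q : Multiset (ZMod m)) (parts : Multiset (Multiset (Z
-- earlier FourfoldSectorComplement (stmt-HodgeConjecture-11126, replaced 2026-08-15T21:29:30Z -> stmt-HodgeConjecture-13828): retired by None — FermatFourfoldsHC → _root_.HodgeConjecture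
-- earlier K3ExhaustionBelow110 (stmt-HodgeConjecture-13831, replaced 2026-08-15T23:15:08Z -> stmt-HodgeConjecture-13929): retired by None — ∀ (m : ℕ) [NeZero m], m < 110 → ∀ s : Multiset (ZMod m), Literature.AlgebraicGeometry.HodgeTheory.FermatCharacter.IsHodgeMultiset s → Multiset.card s = 6 → (∃ (Q : Multiset (ZMod m)) (parts : Multiset (Multiset (ZMod m))), (∀ κ ∈ parts, (Literature.AlgebraicGeom

/-! D-0027 §2.1 — DECIDING THEOREM (planner-authored via `route open/edit --closes-file`; by planner-rchoice-HodgeConjecture-DerivedTorelli-3bbfeca7-0 2026-08-16T03:45:48Z):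
its hypotheses are this route's items and its conclusion the sub-problem Statement (glue_lint), and it elaborates with this file. -/

@[closes "route-HodgeConjecture-DerivedTorelliFermat"] theorem closes (hT : TargetGlue) (hL : HypersurfaceLefschetz) (hM : HodgeModels) (hE : EigenspaceInputs)
    (hS : ShiodaAokiSupply) (hK : K3SectorAlgebraic) (hC : ResidualSectorComplement) :
    _root_.HodgeConjecture :=
  hC (hT hL hM hE hS hK)

end Summit.HodgeConjecture.HodgeConjecture.Theses.DerivedTorelliFermat
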